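import Literature.MathematicalPhysics.QuantumFieldTheory.Balaban1983to89.Node00.HistoryRecursionOfRecord

/-!
# NODE 00 — THE ADMISSIBLE CLASS OF OLDER TERMS OF RECORD: [I] (1.18) «defined and analytic on U^c_j» ∧ «|E^{(j)}(X)| ≤ E₀ e^{−κ d_j(X)}»
# as W1's `Adm`

Fourteenth module of the definer seat `pub-ymgap-node00-def-W1` (g16), a LEAF over storey 4 `Node00.HistoryRecursionOfRecord` (g4∕g5: the one-step
generator `W1.StepGen`, the terms `W1.recTerm G g` GENERATED along a coupling history, the older terms `W1.OlderTerms P 𝔸 M k` of step `k`, and the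
admissibility bookkeeping `W1.RecAdmissible G D Adm` ∕ `W1.RecAdmissibleBelow G D Adm K` ∕ `StepGen.AnalyticInLast D Adm` ∕ `StepGen.PropagatesAnalyticity
D Adm`, all over W1's OWN UNINSTANTIATED PARAMETER `Adm : (k : ℕ) → Set (W1.OlderTerms P 𝔸 M k)` — «that step's admissible class (in print: the inductive
hypotheses (1.18)–(1.19) and analyticity on `U^c_j`, [I] p.263)»).  This module NAMES the class print uses, once, Literature-side:
[I] = [Balaban1987RG1] T. Bałaban, *Renormalization group approach to lattice gauge field theories. I. Generation of effective actions in the small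
field approximation and a coupling constant renormalization in four dimensions*, Commun. Math. Phys. **109** (1987) 249–301 (PDF held
`paper:balaban1987-cmp109-rg-i-small-field`, journal page = PDF page + 248); [II] = [Balaban1988RG2Cluster], part II. Cluster expansions, Commun. Math. Phys.
**116** (1988) 1–22 (PDF held `paper:balaban1988-cmp116-rg-ii-cluster`, journal page = PDF page).

[I] §1 p.263, verbatim: «We assume that the function E^{(j)}(X, g_{j−1}, U, J) is defined and analytic on the space U^c_j(X, α₀, α₁), with some positive,
absolute constants α₀, α₁ (i.e., constants independent of X and j). … There exists a constant E₀ such that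
  |E^{(j)}(X, g_{j−1}, U, J)| ≤ E₀ exp(−κ d_j(X))                                                                                          (1.18)
for M ≥ M(κ), γ sufficiently small, and for all configurations (U, J) ∈ U^c_j(X, α₀, α₁).»

* §1  THE CLASS.  For a space table `sp : (j : ℕ) → 𝐃_j → Set Φ` (the record's is `W1.spaceOfRecord Sg Rz α₀ α₁`, `Node00.HistoryTermsOfRecord` §3:
  `(j, X) ↦ U^c_j(X, α₀ j, α₁ j)`), an amplitude `E₀` and a rate `r₁`:  `W1.SizeAdm sp E₀ r₁ k` = the older-term families `old = (E^{(j)}(Y; ·))_{j ≤ k}`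
  obeying (1.18) on the tables, `W1.FieldAdm sp k` = those analytic at the points of the tables («defined and analytic on U^c_j»), and
  **`W1.AdmHist sp E₀ r₁ k`** = BOTH — typed as the set-builder `{old | (1.18) on the tables ∧ analytic there}` LETTER FOR LETTER as the N18 line spells
  it inline (dag-n18-c `Summits/…/BalabanUVNodesN18HLayerW1TermIndexed` `recAdmissible_ofTerms_of_termwise`, conclusion
  `RecAdmissible (GenTower.ofTerms L T) D fun k => {old | … ∧ …}`; the same text guards `hTan ∕ hT226` there and ≈ 190 binders across the landed
  `…N18HLayerW1*` ∕ `…N18AtRateRecord13*` files), so that every such conclusion IS `W1.RecAdmissible … (W1.AdmHist sp E₀ r₁)` and every such guard IS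
  `∀ old ∈ W1.AdmHist sp E₀ r₁ k, …` by `rfl` ∕ `Iff.rfl` — nothing landed is edited, nothing is re-keyed.  Faces: `mem_AdmHist_iff` (`Iff.rfl`),
  `AdmHist_eq_inter` (`= SizeAdm ∩ FieldAdm`, `rfl`), the rate read with `torusTreeLen` (`mem_AdmHist_iff_torusTreeLen`, `Iff.rfl`: `(domSys P M j).dj Y`
  is `torusTreeLen Y.1` definitionally, `TreeLengthTorus.tsys_dj`) — the currency of the N22 s1 line's size guard (dag-n22-c J9-D `SliceInputs.*_all`,
  J10-DESIGN `DEC old`, R1a `holoBound_recTerm_ofTerms` `hlast`).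
* §2  MONOTONICITY.  Larger amplitude ∕ smaller rate ∕ smaller tables enlarge the class (`SizeAdm_mono`, `AdmHist_mono` — R1a's `hκ : κ ≤ r₁`, `E₀ ≤ A`;
  `SizeAdm_anti_sp ∕ FieldAdm_anti_sp ∕ AdmHist_anti_sp` — the (1.17)-margin tables `W1.SpRestr`, the two-radii tables `thickening ρ (sp j Y) ⊇ sp j Y`).
* §3  THE BINDER BRIDGE.  `forall_mem_AdmHist_iff`: the bounded-quantifier shape `∀ old ∈ W1.AdmHist sp E₀ r₁ k, Q old` (storey 4's `AnalyticInLast ∕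
  PropagatesAnalyticity`, W1-12b §3b `TermDatum214.AnalyticGrowthLettersOn ∕ LocalGrowthLettersOn Adm`) ↔ the N18 line's curried guards
  `∀ old, (1.18)-size → analytic → Q old` VERBATIM; `forall_mem_AdmHist_of_forall_sizeAdm`: a size-only binder is the STRONGER hypothesis (re-guarding a
  consumer by the class breaks no caller).
* §4  GUARDS ALONG A HISTORY (storey 4's bookkeeping READ at the class; [I] p.266 «E^{(j)}, β_j are analytic functions of the effective coupling constants»
  is argued coordinatewise on one-slot updates `g|g_i := z`).  `mem_update_of_forall_mem`; for ANY `Adm`: `RecAdmissibleBelow.mem_update ∕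
  RecAdmissible.mem_update` (the older terms generated along `g|g_i := z` are admissible when `g` is `D`-valued and `z ∈ D`); at the class:
  `guards_update_of_recAdmissibleBelow` (BOTH guards at every older level of every one-slot update, from the displayed bookkeeping binder
  `∀ g, (∀ n, g n ∈ D) → ∀ m < K, olderOf (recTerm G g) m ∈ AdmHist sp E₀ r₁ m` = `RecAdmissibleBelow … K` unfolded), `curveGuard_of_recAdmissibleBelow`
  (the curve `z ↦ olderOf (recTerm G (g|g_i := z)) k'` is pointwise in the class on any `Dᵢ ⊆ D` — the admissibility premise a curve-hypothesis of shape
  `∀ z ∈ O, cv z ∈ Adm` asks, SUPPLIED by the bookkeeping, never assumed anew), and (1.18) ∕ analyticity READ BACK on the generated terms themselves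
  (`norm_recTerm_le_of_recAdmissible[Below]`, `analyticOnNhd_recTerm_of_recAdmissible[Below]`: `olderOf (recTerm G g) j (Fin.last j) = recTerm G g j`).
* §4b  SLOT-WISE COUPLING DOMAINS `D : ℕ → Set ℂ` (`g n ∈ D n`: one coupling moved in a disc with the others frozen, [I] p.266; an interpolation in one
  coupling; a window per coupling): `W1.RecAdmissibleFam G D Adm` ∕ `W1.RecAdmissibleFamBelow G D Adm K` — storey 4's `RecAdmissible[Below]` is the constant-family
  case (`recAdmissibleFam[Below]_const_iff`, `Iff.rfl`) — with `below ∕ of_le ∕ anti_dom ∕ mono_adm`, the junction `of_recAdmissible[Below] (hD : ∀ n, D n ⊆ D₀)`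
  with the single-domain bookkeeping (domain antitonicity from the constant family `D₀ ⊇ D n`; not the lens's «history freeze», which lives with its consumers), `mem_update (hz : z ∈ D i)`, and at the class `curveGuard_of_recAdmissibleFamBelow (hDi :
  Dᵢ ⊆ D i)`, `guards_update_of_recAdmissibleFamBelow` (typed on the transfer lens's located clause, memo v22 item (6)).
* §5  AT THE TABLES OF RECORD.  `mem_AdmHist_spaceOfRecord_iff` (`Iff.rfl`): at `sp := W1.spaceOfRecord Sg Rz α₀ α₁` membership reads
  «`‖old j Y ψ‖ ≤ E₀ e^{−r₁·torusTreeLen Y}` for `ψ ∈ Sect2.spaceI Sg Rz M j (domSites P M j Y) (α₀ j) (α₁ j)` ∧ `AnalyticOnNhd ℂ (old j Y) (spaceI …)`»; with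
  level-constant `α₀ α₁` (`mem_AdmHist_spaceOfRecord_const_iff`) this is the N22 s1 line's `DEC old ∧ (field-analyticity on the spaceI tables)` text.
* §6  HONESTY.  The class is non-empty for `0 ≤ E₀` (`zero_mem_AdmHist`: the zero family — no estimate of Bałaban's is claimed by inhabiting it).

DESIGN (one declarer).  Storey 4 deliberately left `Adm` free («instantiated by the consumer»); the N18 line (dag-n18-c files 17–31, dag-n18-d) then PROVED
the heredity of exactly this class for the term-indexed generator (`recAdmissible_ofTerms_of_termwise`, `recAdmissible_Gn_of_primitives_param`,
`recAdmissible_Gn_of_inputs226Holo`) spelling it inline; the N22 s1 line guarded its history-universal binders by the SIZE half only, and the LENS «transfer»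
located (memo v20 T32, v21 T33; Sketch 20 §A, Sketch 21) that the first∕second-order field letters of the (2.14) datum are FALSE over the size-only class (the
datum evaluates `old` at fluctuation-moved configurations, [I] (2.10)) and that ONE class — this one — serves the ₁₃ knit's conjunct 4 (N18's OUTPUT) and
conjuncts 5–6 (N22's term-level inputs over `Adm`) at once; W1-12b answered the datum-semantics question (R-a) «hypotheses only over W1's `Adm`, instantiated
as size ∧ field-analyticity».  This module is that instantiation's NAME; §3–§4 are the lens's Sketch 21 §B–§C read in W1's namespace (credit:
`ym-lens-BalabanUVNodes-transfer` g21), §5 its §E at `W1.spaceOfRecord`.  HONEST FRAMING: a definition + `rfl` ∕ `Iff.rfl` faces + bookkeeping one-liners;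
nothing of Bałaban's is asserted; no node of `BalabanUVNodes` is discharged; finite tori at fixed ε — not a continuum ∕ OS ∕ mass-gap statement.

[cite: Balaban1987RG1, §1 p.263 ((1.18) and «defined and analytic on U^c_j(X, α₀, α₁)»), (1.11)-(1.16) p.262 (the spaces), §2 p.266 (analyticity in the
effective coupling constants), (2.12)-(2.13) p.268; Balaban1988RG2Cluster, (1.41) p.11, (2.14) p.15 (the older terms enter the generic term through the potentials)]
-/

noncomputable section

open Set

namespace Literature.MathematicalPhysics.QuantumFieldTheory.Balaban1983to89.Node00

open Literature.MathematicalPhysics.QuantumFieldTheory.Balaban1983to89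
open Step B14.Eq213MaximalDomains TreeLengthTorus T4Continuum Sect2

namespace W1

/-! ## §1  The class -/

section TheClass

variable {P : Params} {𝔸 : Type*} {M : ℕ}

/-- **THE (1.18)-SIZE CLASS OF OLDER TERMS AT STEP `k`** on the space table `sp` with amplitude `E₀` and rate `r₁`: the families
`old = (E^{(j)}(Y; ·))_{j ≤ k}` with `|E^{(j)}(Y; ψ)| ≤ E₀ e^{−r₁ d_j(Y)}` for every `ψ ∈ sp j Y` ([I] (1.18) «for all configurations (U, J) ∈ U^c_j(X, α₀, α₁)»).
The size guard of the N22 s1 line (rate read with `torusTreeLen`, the same real number: `mem_SizeAdm_iff_torusTreeLen`).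
[cite: Balaban1987RG1, (1.18) p.263] -/
def SizeAdm (sp : (j : ℕ) → (domSys P M j).Dom → Set (CPair P 𝔸)) (E₀ r₁ : ℝ) (k : ℕ) : Set (OlderTerms P 𝔸 M k) :=
  {old | ∀ (j : Fin (k + 1)) (Y : (domSys P M j).Dom), ∀ ψ ∈ sp j Y, ‖old j Y ψ‖ ≤ E₀ * Real.exp (-(r₁ * (domSys P M j).dj Y))}

/-- Face: membership in the size class, displayed. [cite: Balaban1987RG1, (1.18) p.263] -/
theorem mem_SizeAdm_iff {sp : (j : ℕ) → (domSys P M j).Dom → Set (CPair P 𝔸)} {E₀ r₁ : ℝ} {k : ℕ} (old : OlderTerms P 𝔸 M k) :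
    old ∈ SizeAdm sp E₀ r₁ k ↔
      ∀ (j : Fin (k + 1)) (Y : (domSys P M j).Dom), ∀ ψ ∈ sp j Y, ‖old j Y ψ‖ ≤ E₀ * Real.exp (-(r₁ * (domSys P M j).dj Y)) :=
  Iff.rfl

/-- **THE RATE READ WITH `torusTreeLen`** (the N22 s1 line's currency: `E₀ * Real.exp (-(κ_E * torusTreeLen Y.1))` for `ψ ∈ sp j Y`, binder
`(ψ : CPair P 𝔸), ψ ∈ sp j Y → …`): the same class, by `Iff.rfl` — `(domSys P M j).dj Y` is `torusTreeLen Y.1` definitionally (`Sect2.domSys P M j = tsys P.d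
(domCount P M j)`, `TreeLengthTorus.tsys_dj`). [cite: Balaban1987RG1, (1.18) p.263 with the tree length d_j of (1.17)-(1.18); Balaban1988RG2Cluster, (1.26) p.8] -/
theorem mem_SizeAdm_iff_torusTreeLen {sp : (j : ℕ) → (domSys P M j).Dom → Set (CPair P 𝔸)} {E₀ r₁ : ℝ} {k : ℕ} (old : OlderTerms P 𝔸 M k) :
    old ∈ SizeAdm sp E₀ r₁ k ↔
      ∀ (j : Fin (k + 1)) (Y : (domSys P M j).Dom) (ψ : CPair P 𝔸), ψ ∈ sp j Y → ‖old j Y ψ‖ ≤ E₀ * Real.exp (-(r₁ * torusTreeLen Y.1)) :=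
  Iff.rfl

variable [NormedRing 𝔸] [NormedAlgebra ℂ 𝔸]

/-- **THE FIELD-ANALYTICITY CLASS OF OLDER TERMS AT STEP `k`** on the space table `sp`: every level `E^{(j)}(Y; ·)` analytic at the points of its table
([I] p.263 «E^{(j)}(X, g_{j−1}, U, J) is defined and analytic on the space U^c_j(X, α₀, α₁)»). [cite: Balaban1987RG1, §1 p.263 (clause before (1.18))] -/
def FieldAdm (sp : (j : ℕ) → (domSys P M j).Dom → Set (CPair P 𝔸)) (k : ℕ) : Set (OlderTerms P 𝔸 M k) :=
  {old | ∀ (j : Fin (k + 1)) (Y : (domSys P M j).Dom), AnalyticOnNhd ℂ (old j Y) (sp j Y)}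

/-- **THE ADMISSIBLE CLASS OF OLDER TERMS OF RECORD AT STEP `k`** — [I] §1 p.263's inductive assumption on the previous terms: (1.18) on the tables AND
«defined and analytic on U^c_j» — W1's `Adm` INSTANTIATED.  Typed as the set-builder the N18 line writes inline (dag-n18-c
`…N18HLayerW1TermIndexed` `recAdmissible_ofTerms_of_termwise`, conclusion `RecAdmissible (GenTower.ofTerms L T) D fun k => {old | … ∧ …}`), letter for
letter at a generic parameter record `P`, so that text IS `W1.AdmHist sp E₀ r₁` by `rfl`.  `= SizeAdm ∩ FieldAdm` (`AdmHist_eq_inter`, `rfl`).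
[cite: Balaban1987RG1, §1 p.263 ((1.18) and the clause before it)] -/
def AdmHist (sp : (j : ℕ) → (domSys P M j).Dom → Set (CPair P 𝔸)) (E₀ r₁ : ℝ) (k : ℕ) : Set (OlderTerms P 𝔸 M k) :=
  {old : OlderTerms P 𝔸 M k |
    (∀ (j : Fin (k + 1)) (Y : (domSys P M j).Dom), ∀ ψ ∈ sp j Y, ‖old j Y ψ‖ ≤ E₀ * Real.exp (-(r₁ * (domSys P M j).dj Y))) ∧
      (∀ (j : Fin (k + 1)) (Y : (domSys P M j).Dom), AnalyticOnNhd ℂ (old j Y) (sp j Y))}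

variable {sp : (j : ℕ) → (domSys P M j).Dom → Set (CPair P 𝔸)} {E₀ r₁ : ℝ}

/-- Face: membership in the field-analyticity class, displayed. [cite: Balaban1987RG1, §1 p.263 (clause before (1.18))] -/
theorem mem_FieldAdm_iff {k : ℕ} (old : OlderTerms P 𝔸 M k) :
    old ∈ FieldAdm sp k ↔ ∀ (j : Fin (k + 1)) (Y : (domSys P M j).Dom), AnalyticOnNhd ℂ (old j Y) (sp j Y) :=
  Iff.rfl

/-- **FACE: MEMBERSHIP IN THE ADMISSIBLE CLASS, DISPLAYED** — the N18 line's two guards `(1.18)-size ∧ analytic`, by `Iff.rfl`.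
[cite: Balaban1987RG1, §1 p.263 ((1.18) and the clause before it)] -/
theorem mem_AdmHist_iff {k : ℕ} (old : OlderTerms P 𝔸 M k) :
    old ∈ AdmHist sp E₀ r₁ k ↔
      (∀ (j : Fin (k + 1)) (Y : (domSys P M j).Dom), ∀ ψ ∈ sp j Y, ‖old j Y ψ‖ ≤ E₀ * Real.exp (-(r₁ * (domSys P M j).dj Y))) ∧
        ∀ (j : Fin (k + 1)) (Y : (domSys P M j).Dom), AnalyticOnNhd ℂ (old j Y) (sp j Y) :=
  Iff.rfl

variable (sp E₀ r₁) in
/-- **THE ADMISSIBLE CLASS IS THE SIZE CLASS MEET THE FIELD-ANALYTICITY CLASS**, definitionally. [cite: Balaban1987RG1, §1 p.263 ((1.18) and the clause before it)] -/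
theorem AdmHist_eq_inter (k : ℕ) : AdmHist sp E₀ r₁ k = SizeAdm sp E₀ r₁ k ∩ FieldAdm sp k :=
  rfl

/-- Face: membership in the class is membership in both halves (`Iff.rfl`). [cite: Balaban1987RG1, §1 p.263 ((1.18) and the clause before it)] -/
theorem mem_AdmHist_iff_mem_and_mem {k : ℕ} (old : OlderTerms P 𝔸 M k) :
    old ∈ AdmHist sp E₀ r₁ k ↔ old ∈ SizeAdm sp E₀ r₁ k ∧ old ∈ FieldAdm sp k :=
  Iff.rfl

/-- Constructor face. [cite: Balaban1987RG1, §1 p.263 ((1.18) and the clause before it)] -/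
theorem mem_AdmHist {k : ℕ} {old : OlderTerms P 𝔸 M k} (hsize : old ∈ SizeAdm sp E₀ r₁ k) (han : old ∈ FieldAdm sp k) :
    old ∈ AdmHist sp E₀ r₁ k :=
  ⟨hsize, han⟩

variable (sp E₀ r₁) in
/-- The admissible class lies in the size class. [cite: Balaban1987RG1, (1.18) p.263] -/
theorem AdmHist_subset_SizeAdm (k : ℕ) : AdmHist sp E₀ r₁ k ⊆ SizeAdm sp E₀ r₁ k := fun _ h => h.1

variable (sp E₀ r₁) in
/-- The admissible class lies in the field-analyticity class. [cite: Balaban1987RG1, §1 p.263 (clause before (1.18))] -/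
theorem AdmHist_subset_FieldAdm (k : ℕ) : AdmHist sp E₀ r₁ k ⊆ FieldAdm sp k := fun _ h => h.2

/-- **(1.18) READ OFF A MEMBER.** [cite: Balaban1987RG1, (1.18) p.263] -/
theorem norm_le_of_mem_AdmHist {k : ℕ} {old : OlderTerms P 𝔸 M k} (h : old ∈ AdmHist sp E₀ r₁ k) (j : Fin (k + 1))
    (Y : (domSys P M j).Dom) {ψ : CPair P 𝔸} (hψ : ψ ∈ sp j Y) : ‖old j Y ψ‖ ≤ E₀ * Real.exp (-(r₁ * (domSys P M j).dj Y)) :=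
  h.1 j Y ψ hψ

/-- **FIELD-ANALYTICITY READ OFF A MEMBER.** [cite: Balaban1987RG1, §1 p.263 (clause before (1.18))] -/
theorem analyticOnNhd_of_mem_AdmHist {k : ℕ} {old : OlderTerms P 𝔸 M k} (h : old ∈ AdmHist sp E₀ r₁ k) (j : Fin (k + 1))
    (Y : (domSys P M j).Dom) : AnalyticOnNhd ℂ (old j Y) (sp j Y) :=
  h.2 j Y

/-- **MEMBERSHIP IN THE ADMISSIBLE CLASS, RATE READ WITH `torusTreeLen`** (`Iff.rfl`): the N22 s1 line's size guard ∧ field-analyticity on the tables.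
[cite: Balaban1987RG1, §1 p.263 ((1.18) and the clause before it); Balaban1988RG2Cluster, (1.26) p.8] -/
theorem mem_AdmHist_iff_torusTreeLen {k : ℕ} (old : OlderTerms P 𝔸 M k) :
    old ∈ AdmHist sp E₀ r₁ k ↔
      (∀ (j : Fin (k + 1)) (Y : (domSys P M j).Dom) (ψ : CPair P 𝔸), ψ ∈ sp j Y → ‖old j Y ψ‖ ≤ E₀ * Real.exp (-(r₁ * torusTreeLen Y.1))) ∧
        ∀ (j : Fin (k + 1)) (Y : (domSys P M j).Dom), AnalyticOnNhd ℂ (old j Y) (sp j Y) :=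
  Iff.rfl

end TheClass

/-! ## §2  Monotonicity -/

section Monotone

variable {P : Params} {𝔸 : Type*} {M : ℕ}
variable (sp : (j : ℕ) → (domSys P M j).Dom → Set (CPair P 𝔸))

/-- **LARGER AMPLITUDE, SMALLER RATE ENLARGE THE SIZE CLASS**: `E₀ ≤ A`, `κ ≤ r₁`, `0 ≤ A` give `SizeAdm sp E₀ r₁ k ⊆ SizeAdm sp A κ k` (`d_j ≥ 0`).  A consumer
guarded at `(A, κ)` covers every history admissible at `(E₀, r₁)`. [cite: Balaban1987RG1, (1.18) p.263 (E₀ and κ as absolute constants; bookkeeping)] -/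
theorem SizeAdm_mono {E₀ r₁ A κ : ℝ} (hE : E₀ ≤ A) (hκ : κ ≤ r₁) (hA : 0 ≤ A) (k : ℕ) : SizeAdm sp E₀ r₁ k ⊆ SizeAdm sp A κ k := by
  intro old hold j Y ψ hψ
  refine (hold j Y ψ hψ).trans ?_
  have hd : 0 ≤ (domSys P M j).dj Y := (domSys P M j).dj_nonneg Y
  calc E₀ * Real.exp (-(r₁ * (domSys P M j).dj Y)) ≤ A * Real.exp (-(r₁ * (domSys P M j).dj Y)) :=
        mul_le_mul_of_nonneg_right hE (Real.exp_pos _).le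
    _ ≤ A * Real.exp (-(κ * (domSys P M j).dj Y)) := by
        refine mul_le_mul_of_nonneg_left (Real.exp_le_exp.mpr ?_) hA
        nlinarith

variable {sp}

/-- **SMALLER TABLES ENLARGE THE SIZE CLASS** (pointwise `sp' j Y ⊆ sp j Y`; e.g. the (1.17)-margin tables, `W1.SpRestr`).
[cite: Balaban1987RG1, §1 p.263 (the spaces with smaller constants; bookkeeping)] -/
theorem SizeAdm_anti_sp {sp' : (j : ℕ) → (domSys P M j).Dom → Set (CPair P 𝔸)} (hsp : ∀ (j : ℕ) (Y : (domSys P M j).Dom), sp' j Y ⊆ sp j Y)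
    (E₀ r₁ : ℝ) (k : ℕ) : SizeAdm sp E₀ r₁ k ⊆ SizeAdm sp' E₀ r₁ k :=
  fun _ hold j Y ψ hψ => hold j Y ψ (hsp j Y hψ)

variable [NormedRing 𝔸] [NormedAlgebra ℂ 𝔸]

variable (sp) in
/-- **LARGER AMPLITUDE, SMALLER RATE ENLARGE THE ADMISSIBLE CLASS** (the analyticity half is untouched). [cite: Balaban1987RG1, §1 p.263 ((1.18); bookkeeping)] -/
theorem AdmHist_mono {E₀ r₁ A κ : ℝ} (hE : E₀ ≤ A) (hκ : κ ≤ r₁) (hA : 0 ≤ A) (k : ℕ) : AdmHist sp E₀ r₁ k ⊆ AdmHist sp A κ k :=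
  fun _ hold => ⟨SizeAdm_mono sp hE hκ hA k hold.1, hold.2⟩

/-- **SMALLER TABLES ENLARGE THE FIELD-ANALYTICITY CLASS** (`AnalyticOnNhd.mono`; e.g. `sp j Y ⊆ thickening ρ (sp j Y)` of the two-radii readings).
[cite: Balaban1987RG1, §1 p.263 (the spaces with smaller constants; bookkeeping)] -/
theorem FieldAdm_anti_sp {sp' : (j : ℕ) → (domSys P M j).Dom → Set (CPair P 𝔸)} (hsp : ∀ (j : ℕ) (Y : (domSys P M j).Dom), sp' j Y ⊆ sp j Y)
    (k : ℕ) : FieldAdm sp k ⊆ FieldAdm sp' k :=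
  fun _ hold j Y => (hold j Y).mono (hsp j Y)

/-- **SMALLER TABLES ENLARGE THE ADMISSIBLE CLASS.** [cite: Balaban1987RG1, §1 p.263 (the spaces with smaller constants; bookkeeping)] -/
theorem AdmHist_anti_sp {sp' : (j : ℕ) → (domSys P M j).Dom → Set (CPair P 𝔸)} (hsp : ∀ (j : ℕ) (Y : (domSys P M j).Dom), sp' j Y ⊆ sp j Y)
    (E₀ r₁ : ℝ) (k : ℕ) : AdmHist sp E₀ r₁ k ⊆ AdmHist sp' E₀ r₁ k :=
  fun _ hold => ⟨SizeAdm_anti_sp hsp E₀ r₁ k hold.1, FieldAdm_anti_sp hsp k hold.2⟩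

end Monotone

/-! ## §3  The binder bridge: `∀ old ∈ AdmHist …` ↔ the curried guards `∀ old, size → analytic → …` -/

section Binders

variable {P : Params} {𝔸 : Type*} [NormedRing 𝔸] [NormedAlgebra ℂ 𝔸] {M : ℕ}
variable (sp : (j : ℕ) → (domSys P M j).Dom → Set (CPair P 𝔸)) (E₀ r₁ : ℝ)

/-- **THE BOUNDED-QUANTIFIER BINDER IS THE CURRIED BINDER**: `∀ old ∈ W1.AdmHist sp E₀ r₁ k, Q old` (storey 4's `StepGen.AnalyticInLast ∕ PropagatesAnalyticity`,
W1-12b §3b `AnalyticGrowthLettersOn ∕ LocalGrowthLettersOn Adm`, at `Adm := AdmHist sp E₀ r₁`) ↔ the N18 line's displayed guards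
`∀ old, ((1.18)-size on the tables) → (analytic on the tables) → Q old` (`hTan`, `hT226` of `recAdmissible_ofTerms_of_termwise`), for any predicate `Q`.
[cite: Balaban1987RG1, §1 p.263 ((1.18) and the clause before it; bookkeeping)] -/
theorem forall_mem_AdmHist_iff {k : ℕ} (Q : OlderTerms P 𝔸 M k → Prop) :
    (∀ old ∈ AdmHist sp E₀ r₁ k, Q old) ↔
      ∀ old : OlderTerms P 𝔸 M k,
        (∀ (j : Fin (k + 1)) (Y : (domSys P M j).Dom), ∀ ψ ∈ sp j Y, ‖old j Y ψ‖ ≤ E₀ * Real.exp (-(r₁ * (domSys P M j).dj Y))) →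
        (∀ (j : Fin (k + 1)) (Y : (domSys P M j).Dom), AnalyticOnNhd ℂ (old j Y) (sp j Y)) → Q old :=
  ⟨fun h old hsize han => h old ⟨hsize, han⟩, fun h old hold => h old hold.1 hold.2⟩

/-- The bounded-quantifier binder over the class ↔ the curried binder over its two halves. [cite: Balaban1987RG1, §1 p.263 (bookkeeping)] -/
theorem forall_mem_AdmHist_iff_sizeAdm_fieldAdm {k : ℕ} (Q : OlderTerms P 𝔸 M k → Prop) :
    (∀ old ∈ AdmHist sp E₀ r₁ k, Q old) ↔ ∀ old, old ∈ SizeAdm sp E₀ r₁ k → old ∈ FieldAdm sp k → Q old :=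
  ⟨fun h old hsize han => h old ⟨hsize, han⟩, fun h old hold => h old hold.1 hold.2⟩

/-- **A SIZE-ONLY BINDER IS THE STRONGER HYPOTHESIS**: a property asked of every (1.18)-size-admissible family holds on the admissible class — re-guarding a
consumer's `∀ old, size → Q old` by the class breaks no caller; only the inhabitant's burden changes. [cite: Balaban1987RG1, §1 p.263 (bookkeeping)] -/
theorem forall_mem_AdmHist_of_forall_sizeAdm {k : ℕ} (Q : OlderTerms P 𝔸 M k → Prop) (h : ∀ old ∈ SizeAdm sp E₀ r₁ k, Q old) :
    ∀ old ∈ AdmHist sp E₀ r₁ k, Q old :=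
  fun old hold => h old hold.1

end Binders

/-! ## §4  Guards along a coupling history: storey 4's bookkeeping read at the class -/

section Guards

variable {P : Params} {𝔸 : Type*} {M : ℕ}

/-- Updating one coupling of a `D`-valued history by a value of `D` keeps it `D`-valued (the one-slot updates `g|g_i := z` of the coordinate sections
[I] p.266 argues on). [cite: Balaban1987RG1, §2 p.266 (coordinatewise analyticity; bookkeeping)] -/
theorem mem_update_of_forall_mem {α : Type*} {D : Set α} {g : ℕ → α} (hg : ∀ n, g n ∈ D) (i : ℕ) {z : α} (hz : z ∈ D) (n : ℕ) :
    Function.update g i z n ∈ D := by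
  rcases eq_or_ne n i with rfl | hne
  · rw [Function.update_self]
    exact hz
  · rw [Function.update_of_ne hne]
    exact hg n

/-- **THE BOOKKEEPING BELOW A RUN LENGTH, APPLIED ALONG A ONE-SLOT UPDATE** (any class `Adm`): the older terms generated along `g|g_i := z` at a step
`m < K` are admissible when `g` is `D`-valued and `z ∈ D`. [cite: Balaban1987RG1, §1 p.263 and §2 p.266 (bookkeeping)] -/
theorem RecAdmissibleBelow.mem_update {G : GenTower P 𝔸 M} {D : Set ℂ} {Adm : (k : ℕ) → Set (OlderTerms P 𝔸 M k)} {K : ℕ}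
    (h : RecAdmissibleBelow G D Adm K) {g : ℕ → ℂ} (hg : ∀ n, g n ∈ D) (i : ℕ) {z : ℂ} (hz : z ∈ D) (m : ℕ) (hm : m < K) :
    olderOf (recTerm G (Function.update g i z)) m ∈ Adm m :=
  h _ (mem_update_of_forall_mem hg i hz) m hm

/-- **THE ALL-STEPS BOOKKEEPING, APPLIED ALONG A ONE-SLOT UPDATE** (any class `Adm`). [cite: Balaban1987RG1, §1 p.263 and §2 p.266 (bookkeeping)] -/
theorem RecAdmissible.mem_update {G : GenTower P 𝔸 M} {D : Set ℂ} {Adm : (k : ℕ) → Set (OlderTerms P 𝔸 M k)}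
    (h : RecAdmissible G D Adm) {g : ℕ → ℂ} (hg : ∀ n, g n ∈ D) (i : ℕ) {z : ℂ} (hz : z ∈ D) (m : ℕ) :
    olderOf (recTerm G (Function.update g i z)) m ∈ Adm m :=
  h _ (mem_update_of_forall_mem hg i hz) m

/-! ### §4b  Slot-wise coupling domains: the bookkeeping along histories `g` with `g n ∈ D n` -/

/-- **ADMISSIBILITY BOOKKEEPING ALONG HISTORIES IN SLOT-WISE COUPLING DOMAINS** `D : ℕ → Set ℂ` (the coupling `g_n` ranges over `D n`): along every such
history the generated older terms of every step lie in that step's class `Adm`.  Storey 4's `W1.RecAdmissible G D Adm` is the constant-family case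
(`recAdmissibleFam_const_iff`, `Iff.rfl`); slot-wise domains arise when ONE coupling is moved in a disc with the others frozen ([I] p.266's coordinatewise
analyticity; an interpolation in one coupling) or when each coupling carries its own window.  Hypothesis-schema; asserted nowhere.
[cite: Balaban1987RG1, §1 p.263 (the inductive assumptions) and §2 p.266 (analyticity in each effective coupling constant)] -/
def RecAdmissibleFam (G : GenTower P 𝔸 M) (D : ℕ → Set ℂ) (Adm : (k : ℕ) → Set (OlderTerms P 𝔸 M k)) : Prop :=
  ∀ g : ℕ → ℂ, (∀ n, g n ∈ D n) → ∀ k, olderOf (recTerm G g) k ∈ Adm k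

/-- **THE SLOT-WISE BOOKKEEPING BELOW A RUN LENGTH** (steps `k < K` only, as storey 4's `W1.RecAdmissibleBelow`).  Hypothesis-schema; asserted nowhere.
[cite: Balaban1987RG1, §1 p.263 and §2 p.266 with (0.23)-(0.24) pp.256-257] -/
def RecAdmissibleFamBelow (G : GenTower P 𝔸 M) (D : ℕ → Set ℂ) (Adm : (k : ℕ) → Set (OlderTerms P 𝔸 M k)) (K : ℕ) : Prop :=
  ∀ g : ℕ → ℂ, (∀ n, g n ∈ D n) → ∀ k < K, olderOf (recTerm G g) k ∈ Adm k

/-- Face: the slot-wise bookkeeping, displayed. [cite: Balaban1987RG1, §1 p.263 (bookkeeping)] -/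
theorem recAdmissibleFam_iff (G : GenTower P 𝔸 M) (D : ℕ → Set ℂ) (Adm : (k : ℕ) → Set (OlderTerms P 𝔸 M k)) :
    RecAdmissibleFam G D Adm ↔ ∀ g : ℕ → ℂ, (∀ n, g n ∈ D n) → ∀ k, olderOf (recTerm G g) k ∈ Adm k :=
  Iff.rfl

/-- Face: the slot-wise bookkeeping below `K`, displayed. [cite: Balaban1987RG1, §1 p.263 (bookkeeping)] -/
theorem recAdmissibleFamBelow_iff (G : GenTower P 𝔸 M) (D : ℕ → Set ℂ) (Adm : (k : ℕ) → Set (OlderTerms P 𝔸 M k)) (K : ℕ) :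
    RecAdmissibleFamBelow G D Adm K ↔ ∀ g : ℕ → ℂ, (∀ n, g n ∈ D n) → ∀ k < K, olderOf (recTerm G g) k ∈ Adm k :=
  Iff.rfl

/-- **STOREY 4's `RecAdmissible` IS THE CONSTANT-FAMILY CASE** (`Iff.rfl`). [cite: Balaban1987RG1, §1 p.263 (bookkeeping)] -/
theorem recAdmissibleFam_const_iff (G : GenTower P 𝔸 M) (D : Set ℂ) (Adm : (k : ℕ) → Set (OlderTerms P 𝔸 M k)) :
    RecAdmissibleFam G (fun _ => D) Adm ↔ RecAdmissible G D Adm :=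
  Iff.rfl

/-- Storey 4's `RecAdmissibleBelow` is the constant-family case below `K` (`Iff.rfl`). [cite: Balaban1987RG1, §1 p.263 (bookkeeping)] -/
theorem recAdmissibleFamBelow_const_iff (G : GenTower P 𝔸 M) (D : Set ℂ) (Adm : (k : ℕ) → Set (OlderTerms P 𝔸 M k)) (K : ℕ) :
    RecAdmissibleFamBelow G (fun _ => D) Adm K ↔ RecAdmissibleBelow G D Adm K :=
  Iff.rfl

/-- All steps give the steps below any `K`. [cite: Balaban1987RG1, §1 p.263 (bookkeeping)] -/
theorem RecAdmissibleFam.below {G : GenTower P 𝔸 M} {D : ℕ → Set ℂ} {Adm : (k : ℕ) → Set (OlderTerms P 𝔸 M k)} (h : RecAdmissibleFam G D Adm)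
    (K : ℕ) : RecAdmissibleFamBelow G D Adm K :=
  fun g hg k _ => h g hg k

/-- A shorter run length asks less. [cite: Balaban1987RG1, §1 p.263 with (0.23)-(0.24) pp.256-257 (bookkeeping)] -/
theorem RecAdmissibleFamBelow.of_le {G : GenTower P 𝔸 M} {D : ℕ → Set ℂ} {Adm : (k : ℕ) → Set (OlderTerms P 𝔸 M k)} {K K' : ℕ}
    (h : RecAdmissibleFamBelow G D Adm K) (hK : K' ≤ K) : RecAdmissibleFamBelow G D Adm K' :=
  fun g hg k hk => h g hg k (lt_of_lt_of_le hk hK)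

/-- **SMALLER SLOT DOMAINS ASK LESS** (`D' n ⊆ D n`). [cite: Balaban1987RG1, §1 p.263 (bookkeeping)] -/
theorem RecAdmissibleFam.anti_dom {G : GenTower P 𝔸 M} {D D' : ℕ → Set ℂ} {Adm : (k : ℕ) → Set (OlderTerms P 𝔸 M k)} (h : RecAdmissibleFam G D Adm)
    (hD : ∀ n, D' n ⊆ D n) : RecAdmissibleFam G D' Adm :=
  fun g hg k => h g (fun n => hD n (hg n)) k

/-- Smaller slot domains ask less, below a run length. [cite: Balaban1987RG1, §1 p.263 (bookkeeping)] -/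
theorem RecAdmissibleFamBelow.anti_dom {G : GenTower P 𝔸 M} {D D' : ℕ → Set ℂ} {Adm : (k : ℕ) → Set (OlderTerms P 𝔸 M k)} {K : ℕ}
    (h : RecAdmissibleFamBelow G D Adm K) (hD : ∀ n, D' n ⊆ D n) : RecAdmissibleFamBelow G D' Adm K :=
  fun g hg k hk => h g (fun n => hD n (hg n)) k hk

/-- A larger class asks less. [cite: Balaban1987RG1, §1 p.263 (bookkeeping)] -/
theorem RecAdmissibleFam.mono_adm {G : GenTower P 𝔸 M} {D : ℕ → Set ℂ} {Adm Adm' : (k : ℕ) → Set (OlderTerms P 𝔸 M k)} (h : RecAdmissibleFam G D Adm)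
    (hAdm : ∀ k, Adm k ⊆ Adm' k) : RecAdmissibleFam G D Adm' :=
  fun g hg k => hAdm k (h g hg k)

/-- A larger class asks less, below a run length. [cite: Balaban1987RG1, §1 p.263 (bookkeeping)] -/
theorem RecAdmissibleFamBelow.mono_adm {G : GenTower P 𝔸 M} {D : ℕ → Set ℂ} {Adm Adm' : (k : ℕ) → Set (OlderTerms P 𝔸 M k)} {K : ℕ}
    (h : RecAdmissibleFamBelow G D Adm K) (hAdm : ∀ k, Adm k ⊆ Adm' k) : RecAdmissibleFamBelow G D Adm' K :=
  fun g hg k hk => hAdm k (h g hg k hk)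

/-- **THE JUNCTION WITH THE SINGLE-DOMAIN BOOKKEEPING = DOMAIN ANTITONICITY FROM THE CONSTANT FAMILY** (a single domain `D₀ ⊇ D n` containing every slot):
storey 4's `RecAdmissible G D₀ Adm` (for the term-indexed generator: the N18 line's OUTPUT) gives the slot-wise bookkeeping on every family inside `D₀`.  (This is
NOT the «history freeze» of the transfer lens's T35 — a statement about `GenTower.ofTerms` with the couplings frozen at `g`, which lives with its consumers.) [cite: Balaban1987RG1, §1 p.263 and §2 p.266 (bookkeeping)] -/
theorem RecAdmissibleFam.of_recAdmissible {G : GenTower P 𝔸 M} {D₀ : Set ℂ} {D : ℕ → Set ℂ} {Adm : (k : ℕ) → Set (OlderTerms P 𝔸 M k)}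
    (h : RecAdmissible G D₀ Adm) (hD : ∀ n, D n ⊆ D₀) : RecAdmissibleFam G D Adm :=
  fun g hg k => h g (fun n => hD n (hg n)) k

/-- The junction below a run length: `RecAdmissibleBelow G D₀ Adm K` with `D n ⊆ D₀` gives `RecAdmissibleFamBelow G D Adm K`.
[cite: Balaban1987RG1, §1 p.263 and §2 p.266 with (0.23)-(0.24) pp.256-257 (bookkeeping)] -/
theorem RecAdmissibleFamBelow.of_recAdmissibleBelow {G : GenTower P 𝔸 M} {D₀ : Set ℂ} {D : ℕ → Set ℂ} {Adm : (k : ℕ) → Set (OlderTerms P 𝔸 M k)}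
    {K : ℕ} (h : RecAdmissibleBelow G D₀ Adm K) (hD : ∀ n, D n ⊆ D₀) : RecAdmissibleFamBelow G D Adm K :=
  fun g hg k hk => h g (fun n => hD n (hg n)) k hk

/-- Updating the `i`-th coupling of a history with `g n ∈ D n` by a value of `D i` keeps every slot in its domain. [cite: Balaban1987RG1, §2 p.266 (coordinatewise analyticity; bookkeeping)] -/
theorem mem_update_of_forall_mem_fam {α : Type*} {D : ℕ → Set α} {g : ℕ → α} (hg : ∀ n, g n ∈ D n) (i : ℕ) {z : α} (hz : z ∈ D i) (n : ℕ) :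
    Function.update g i z n ∈ D n := by
  rcases eq_or_ne n i with rfl | hne
  · rw [Function.update_self]
    exact hz
  · rw [Function.update_of_ne hne]
    exact hg n

/-- **THE SLOT-WISE BOOKKEEPING BELOW A RUN LENGTH, APPLIED ALONG A ONE-SLOT UPDATE** (any class `Adm`): with `g n ∈ D n` and `z ∈ D i`, the older terms
generated along `g|g_i := z` at a step `m < K` are admissible. [cite: Balaban1987RG1, §1 p.263 and §2 p.266 (bookkeeping)] -/
theorem RecAdmissibleFamBelow.mem_update {G : GenTower P 𝔸 M} {D : ℕ → Set ℂ} {Adm : (k : ℕ) → Set (OlderTerms P 𝔸 M k)} {K : ℕ}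
    (h : RecAdmissibleFamBelow G D Adm K) {g : ℕ → ℂ} (hg : ∀ n, g n ∈ D n) (i : ℕ) {z : ℂ} (hz : z ∈ D i) (m : ℕ) (hm : m < K) :
    olderOf (recTerm G (Function.update g i z)) m ∈ Adm m :=
  h _ (mem_update_of_forall_mem_fam hg i hz) m hm

/-- The all-steps slot-wise bookkeeping, applied along a one-slot update (any class `Adm`). [cite: Balaban1987RG1, §1 p.263 and §2 p.266 (bookkeeping)] -/
theorem RecAdmissibleFam.mem_update {G : GenTower P 𝔸 M} {D : ℕ → Set ℂ} {Adm : (k : ℕ) → Set (OlderTerms P 𝔸 M k)}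
    (h : RecAdmissibleFam G D Adm) {g : ℕ → ℂ} (hg : ∀ n, g n ∈ D n) (i : ℕ) {z : ℂ} (hz : z ∈ D i) (m : ℕ) :
    olderOf (recTerm G (Function.update g i z)) m ∈ Adm m :=
  h _ (mem_update_of_forall_mem_fam hg i hz) m

variable [NormedRing 𝔸] [NormedAlgebra ℂ 𝔸]
variable (sp : (j : ℕ) → (domSys P M j).Dom → Set (CPair P 𝔸)) (E₀ r₁ : ℝ)

/-- **BOTH GUARDS AT EVERY OLDER LEVEL OF EVERY ONE-SLOT UPDATE, FROM THE DISPLAYED BOOKKEEPING BINDER AT THE CLASS** (the binder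
`∀ g, (∀ n, g n ∈ D) → ∀ m < K, olderOf (recTerm G g) m ∈ AdmHist sp E₀ r₁ m` is `RecAdmissibleBelow G D (AdmHist sp E₀ r₁) K` unfolded — for the
term-indexed generator it is the N18 line's `recAdmissible_ofTerms_of_termwise` read below the run length): what a last-coupling ∕ propagation hypothesis
guarded by the class is applied to at `old := olderOf (recTerm G (g|g_i := z)) m` — size AND analyticity, supplied, with no new induction.
[cite: Balaban1987RG1, §1 p.263 ((1.18) and the clause before it) and §2 p.266] -/
theorem guards_update_of_recAdmissibleBelow {G : GenTower P 𝔸 M} {D : Set ℂ} {K : ℕ}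
    (hAdm : ∀ g : ℕ → ℂ, (∀ n, g n ∈ D) → ∀ m < K, olderOf (recTerm G g) m ∈ AdmHist sp E₀ r₁ m)
    {g : ℕ → ℂ} (hg : ∀ n, g n ∈ D) (i : ℕ) {z : ℂ} (hz : z ∈ D) (m : ℕ) (hm : m < K) :
    olderOf (recTerm G (Function.update g i z)) m ∈ SizeAdm sp E₀ r₁ m ∧ olderOf (recTerm G (Function.update g i z)) m ∈ FieldAdm sp m :=
  hAdm _ (mem_update_of_forall_mem hg i hz) m hm

/-- The all-steps form: `RecAdmissible G D (AdmHist sp E₀ r₁)` (the N18 line's conclusion, by `rfl`) gives both guards along every `D`-valued history at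
every step. [cite: Balaban1987RG1, §1 p.263 ((1.18) and the clause before it)] -/
theorem guards_of_recAdmissible {G : GenTower P 𝔸 M} {D : Set ℂ} (hAdm : RecAdmissible G D (AdmHist sp E₀ r₁))
    {g : ℕ → ℂ} (hg : ∀ n, g n ∈ D) (m : ℕ) :
    olderOf (recTerm G g) m ∈ SizeAdm sp E₀ r₁ m ∧ olderOf (recTerm G g) m ∈ FieldAdm sp m :=
  hAdm g hg m

/-- **THE CURVE OF OLDER TERMS ALONG A ONE-SLOT UPDATE IS POINTWISE ADMISSIBLE** on any `Dᵢ ⊆ D`: the admissibility premise `∀ z ∈ Dᵢ, cv z ∈ Adm` that a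
curve hypothesis (storey 4's `PropagatesAnalyticity`; a consumer's `∀ z ∈ O, cv z ∈ …`) asks at `cv z := olderOf (recTerm G (g|g_i := z)) k'` — SUPPLIED by the
bookkeeping below the run length, not assumed anew. [cite: Balaban1987RG1, §2 p.266 with §1 p.263; Balaban1988RG2Cluster, (1.41) p.11 and (2.14) p.15] -/
theorem curveGuard_of_recAdmissibleBelow {G : GenTower P 𝔸 M} {D Di : Set ℂ} (hDi : Di ⊆ D) {K : ℕ}
    (hAdm : ∀ g : ℕ → ℂ, (∀ n, g n ∈ D) → ∀ m < K, olderOf (recTerm G g) m ∈ AdmHist sp E₀ r₁ m)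
    {g : ℕ → ℂ} (hg : ∀ n, g n ∈ D) (i k' : ℕ) (hk' : k' < K) :
    ∀ z ∈ Di, olderOf (recTerm G (Function.update g i z)) k' ∈ AdmHist sp E₀ r₁ k' :=
  fun _ hz => hAdm _ (mem_update_of_forall_mem hg i (hDi hz)) k' hk'

/-- **THE CURVE OF OLDER TERMS ALONG A ONE-SLOT UPDATE IS POINTWISE ADMISSIBLE — SLOT-WISE DOMAINS**: under `RecAdmissibleFamBelow G D (AdmHist sp E₀ r₁) K`, for
`g n ∈ D n` and any `Dᵢ ⊆ D i`, the curve `z ↦ olderOf (recTerm G (g|g_i := z)) k'` (`k' < K`) lies in the class for `z ∈ Dᵢ` (the interpolation ∕ moved-coupling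
towers). [cite: Balaban1987RG1, §2 p.266 with §1 p.263; Balaban1988RG2Cluster, (1.41) p.11 and (2.14) p.15] -/
theorem curveGuard_of_recAdmissibleFamBelow {G : GenTower P 𝔸 M} {D : ℕ → Set ℂ} {i : ℕ} {Di : Set ℂ} (hDi : Di ⊆ D i) {K : ℕ}
    (hAdm : RecAdmissibleFamBelow G D (AdmHist sp E₀ r₁) K) {g : ℕ → ℂ} (hg : ∀ n, g n ∈ D n) (k' : ℕ) (hk' : k' < K) :
    ∀ z ∈ Di, olderOf (recTerm G (Function.update g i z)) k' ∈ AdmHist sp E₀ r₁ k' :=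
  fun _ hz => hAdm.mem_update hg i (hDi hz) k' hk'

/-- Both guards at every older level of every one-slot update, slot-wise domains. [cite: Balaban1987RG1, §1 p.263 ((1.18) and the clause before it) and §2 p.266] -/
theorem guards_update_of_recAdmissibleFamBelow {G : GenTower P 𝔸 M} {D : ℕ → Set ℂ} {K : ℕ} (hAdm : RecAdmissibleFamBelow G D (AdmHist sp E₀ r₁) K)
    {g : ℕ → ℂ} (hg : ∀ n, g n ∈ D n) (i : ℕ) {z : ℂ} (hz : z ∈ D i) (m : ℕ) (hm : m < K) :
    olderOf (recTerm G (Function.update g i z)) m ∈ SizeAdm sp E₀ r₁ m ∧ olderOf (recTerm G (Function.update g i z)) m ∈ FieldAdm sp m :=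
  hAdm.mem_update hg i hz m hm

/-- **(1.18) READ BACK ON THE GENERATED TERMS**: under the all-steps bookkeeping at the class, every term generated along a `D`-valued history obeys
`|E^{(j)}(Y; ψ)| ≤ E₀ e^{−r₁ d_j(Y)}` on its table (`olderOf (recTerm G g) j (Fin.last j) = recTerm G g j`). [cite: Balaban1987RG1, (1.18) p.263 and Thm 1 p.259] -/
theorem norm_recTerm_le_of_recAdmissible {G : GenTower P 𝔸 M} {D : Set ℂ} (hAdm : RecAdmissible G D (AdmHist sp E₀ r₁))
    {g : ℕ → ℂ} (hg : ∀ n, g n ∈ D) (j : ℕ) (Y : (domSys P M j).Dom) {ψ : CPair P 𝔸} (hψ : ψ ∈ sp j Y) :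
    ‖recTerm G g j Y ψ‖ ≤ E₀ * Real.exp (-(r₁ * (domSys P M j).dj Y)) :=
  (hAdm g hg j).1 (Fin.last j) Y ψ hψ

/-- **FIELD-ANALYTICITY READ BACK ON THE GENERATED TERMS**: under the all-steps bookkeeping at the class, every term generated along a `D`-valued history is
analytic at the points of its table. [cite: Balaban1987RG1, §1 p.263 (clause before (1.18)) and Thm 1 p.259] -/
theorem analyticOnNhd_recTerm_of_recAdmissible {G : GenTower P 𝔸 M} {D : Set ℂ} (hAdm : RecAdmissible G D (AdmHist sp E₀ r₁))
    {g : ℕ → ℂ} (hg : ∀ n, g n ∈ D) (j : ℕ) (Y : (domSys P M j).Dom) : AnalyticOnNhd ℂ (recTerm G g j Y) (sp j Y) :=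
  (hAdm g hg j).2 (Fin.last j) Y

/-- (1.18) read back on the generated terms of the steps below a run length. [cite: Balaban1987RG1, (1.18) p.263 with (0.23)-(0.24) pp.256-257] -/
theorem norm_recTerm_le_of_recAdmissibleBelow {G : GenTower P 𝔸 M} {D : Set ℂ} {K : ℕ} (hAdm : RecAdmissibleBelow G D (AdmHist sp E₀ r₁) K)
    {g : ℕ → ℂ} (hg : ∀ n, g n ∈ D) (j : ℕ) (hj : j < K) (Y : (domSys P M j).Dom) {ψ : CPair P 𝔸} (hψ : ψ ∈ sp j Y) :
    ‖recTerm G g j Y ψ‖ ≤ E₀ * Real.exp (-(r₁ * (domSys P M j).dj Y)) :=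
  (hAdm g hg j hj).1 (Fin.last j) Y ψ hψ

/-- Field-analyticity read back on the generated terms of the steps below a run length. [cite: Balaban1987RG1, §1 p.263 with (0.23)-(0.24) pp.256-257] -/
theorem analyticOnNhd_recTerm_of_recAdmissibleBelow {G : GenTower P 𝔸 M} {D : Set ℂ} {K : ℕ} (hAdm : RecAdmissibleBelow G D (AdmHist sp E₀ r₁) K)
    {g : ℕ → ℂ} (hg : ∀ n, g n ∈ D) (j : ℕ) (hj : j < K) (Y : (domSys P M j).Dom) : AnalyticOnNhd ℂ (recTerm G g j Y) (sp j Y) :=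
  (hAdm g hg j hj).2 (Fin.last j) Y

end Guards

/-! ## §5  At the space tables of record `W1.spaceOfRecord Sg Rz α₀ α₁` -/

section AtRecordTables

variable {P : Params} {𝔸 : Type*} [NormedRing 𝔸] [NormedAlgebra ℂ 𝔸] [CompleteSpace 𝔸] {G : Type*} [Group G] {M : ℕ}
variable (Sg : Setting 𝔸 G) (Rz : Residual P 𝔸)

/-- **AT THE SPACE TABLES OF RECORD** `(j, Y) ↦ U^c_j(Y, α₀ j, α₁ j)` (`W1.spaceOfRecord`, [I] p.263's spaces with level-dependent constants): membership in
the admissible class reads «`‖old j Y ψ‖ ≤ E₀ e^{−r₁·torusTreeLen Y}` for `ψ ∈ spaceI Sg Rz M j (domSites P M j Y) (α₀ j) (α₁ j)`» ∧ «`old j Y` analytic at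
those points», by `Iff.rfl`. [cite: Balaban1987RG1, §1 p.263 ((1.18) and the clause before it), (1.11)-(1.16) p.262] -/
theorem mem_AdmHist_spaceOfRecord_iff (α₀ α₁ : ℕ → ℝ) (E₀ r₁ : ℝ) {k : ℕ} (old : OlderTerms P 𝔸 M k) :
    old ∈ AdmHist (spaceOfRecord (M := M) Sg Rz α₀ α₁) E₀ r₁ k ↔
      (∀ (j : Fin (k + 1)) (Y : (domSys P M j).Dom) (ψ : CPair P 𝔸), ψ ∈ spaceI Sg Rz M j (domSites P M j Y) (α₀ j) (α₁ j) →
          ‖old j Y ψ‖ ≤ E₀ * Real.exp (-(r₁ * torusTreeLen Y.1))) ∧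
        ∀ (j : Fin (k + 1)) (Y : (domSys P M j).Dom), AnalyticOnNhd ℂ (old j Y) (spaceI Sg Rz M j (domSites P M j Y) (α₀ j) (α₁ j)) :=
  Iff.rfl

/-- **AT THE SPACE TABLES OF RECORD WITH LEVEL-CONSTANT `α₀, α₁`** ([I] p.263 «positive, absolute constants α₀, α₁ (i.e., constants independent of X and
j)»; the N22 s1 line's tables `spaceI Sg Rz M j (domSites P M j Y) α₀ α₁`): membership is that line's size guard (`DEC old`, rate `κ_E`, `torusTreeLen`) ∧
field-analyticity on the same tables, by `Iff.rfl`. [cite: Balaban1987RG1, §1 p.263 ((1.18) and the clause before it), (1.11)-(1.16) p.262] -/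
theorem mem_AdmHist_spaceOfRecord_const_iff (α₀ α₁ : ℝ) (E₀ κE : ℝ) {k : ℕ} (old : OlderTerms P 𝔸 M k) :
    old ∈ AdmHist (spaceOfRecord (M := M) Sg Rz (fun _ => α₀) (fun _ => α₁)) E₀ κE k ↔
      (∀ (j : Fin (k + 1)) (Y : (domSys P M j).Dom) (ψ : CPair P 𝔸), ψ ∈ spaceI Sg Rz M j (domSites P M j Y) α₀ α₁ →
          ‖old j Y ψ‖ ≤ E₀ * Real.exp (-(κE * torusTreeLen Y.1))) ∧
        ∀ (j : Fin (k + 1)) (Y : (domSys P M j).Dom), AnalyticOnNhd ℂ (old j Y) (spaceI Sg Rz M j (domSites P M j Y) α₀ α₁) :=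
  Iff.rfl

end AtRecordTables

/-! ## §6  Honesty: the class is non-empty -/

section Honesty

variable {P : Params} {𝔸 : Type*} {M : ℕ}
variable (sp : (j : ℕ) → (domSys P M j).Dom → Set (CPair P 𝔸)) {E₀ : ℝ} (r₁ : ℝ)

/-- The zero family of older terms lies in the size class for `0 ≤ E₀`. [cite: Balaban1987RG1, (1.18) p.263 (non-vacuity of the schema; no estimate claimed)] -/
theorem zero_mem_SizeAdm (hE : 0 ≤ E₀) (k : ℕ) : (0 : OlderTerms P 𝔸 M k) ∈ SizeAdm sp E₀ r₁ k := by
  intro j Y ψ _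
  simp only [Pi.zero_apply, norm_zero]
  positivity

variable [NormedRing 𝔸] [NormedAlgebra ℂ 𝔸]

/-- The zero family of older terms lies in the field-analyticity class. [cite: Balaban1987RG1, §1 p.263 (non-vacuity of the schema; no estimate claimed)] -/
theorem zero_mem_FieldAdm (k : ℕ) : (0 : OlderTerms P 𝔸 M k) ∈ FieldAdm sp k := by
  intro j Y
  show AnalyticOnNhd ℂ (fun _ : CPair P 𝔸 => (0 : ℂ)) (sp j Y)
  exact analyticOnNhd_const

/-- **THE ADMISSIBLE CLASS IS NON-EMPTY** for `0 ≤ E₀`: the zero family (the hypothesis schemas over `W1.AdmHist` are not vacuously true for want of members; no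
estimate of Bałaban's is claimed by this inhabitant). [cite: Balaban1987RG1, §1 p.263 (non-vacuity of the schema; no estimate claimed)] -/
theorem zero_mem_AdmHist (hE : 0 ≤ E₀) (k : ℕ) : (0 : OlderTerms P 𝔸 M k) ∈ AdmHist sp E₀ r₁ k :=
  ⟨zero_mem_SizeAdm sp r₁ hE k, zero_mem_FieldAdm sp k⟩

/-- The admissible class is non-empty for `0 ≤ E₀`. [cite: Balaban1987RG1, §1 p.263 (non-vacuity of the schema; no estimate claimed)] -/
theorem AdmHist_nonempty (hE : 0 ≤ E₀) (k : ℕ) : (AdmHist sp E₀ r₁ k).Nonempty :=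
  ⟨0, zero_mem_AdmHist sp r₁ hE k⟩

end Honesty

end W1

end Literature.MathematicalPhysics.QuantumFieldTheory.Balaban1983to89.Node00

end
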